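import Mathlib.RingTheory.WittVector.Isocrystal
import Mathlib.LinearAlgebra.Semisimple
import Mathlib.LinearAlgebra.Charpoly.Basic
import Mathlib.FieldTheory.IsAlgClosed.Basic
import Mathlib.FieldTheory.Perfect
import Mathlib.RingTheory.SimpleRing.Basic
import HarnessLib

/-!
# Kottwitz (1992), §11 — Semisimple isocrystals over `L_r` (pp. 410–412): Lemmas 11.1–11.6 as named facts

Carpet file of squad TK (cell `hodgecm-mathlib`), source [Kottwitz1992] = R. E. Kottwitz, *Points on some
Shimura varieties over finite fields*, J. Amer. Math. Soc. **5** (1992) 373–444, §11 «Semisimple isocrystals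
over `L_r`», printed pp. 410–412 (held text `paper:doi-10-2307-2152772`, pdf p. N = printed p. 372+N; statements
read on p0038–p0040).  STATEMENTS ONLY (typer lint rule): every numbered lemma of §11 is a named fact
`def Kottwitz1992_11_<m>_<name> … : Prop := …`; no proof, no `sorry`, no `axiom`, no `instance`, no notation.
The interface definitions of this file (`qp`, `kScalar`, `IsFrob`, `EndPhi`, `adjoinQp`, `IsStable`,
`IsSemisimpleObj`, `IsSimpleObj`, `bAct`, `IsBObject`, `IsSimpleBObject`, `EndB`, `adjoinF`) are the paper's own
notions (p. 410, p. 411), with bodies, over Mathlib's Witt-vector isocrystals (`WittVector.Isocrystal`).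

## The setting (p. 410) and how it is typed

«As in §10, `L_r` denotes the fraction field of the Witt ring `W(k_r)`» (`k_r` the field with `p^r` elements, §10):
here `k` is any finite field with `Fintype.card k = p ^ r` (a hypothesis of every fact) and `L_r` is Mathlib's
`K(p, k) = FractionRing (WittVector p k)` with its Frobenius `σ = WittVector.FractionRing.frobeniusRingHom p k`.
«An isocrystal over `L_r` is a finite-dimensional `L_r`-vector space `V` together with a `σ`-linear bijection `Φ`
from `V` to itself» = Mathlib's class `WittVector.Isocrystal p k V` (`Φ = Φ(p, k)`) plus `Module.Finite K(p,k) V`.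
The subfield `ℚ_p ⊂ L_r` is typed as the fixed ring `qp p k` of `σ` (the paper's `ℚ_p`: `L_r/ℚ_p` is the unramified
extension of degree `r` and `ℚ_p = L_r^σ` [folklore]); `ℚ_p`-algebras, `ℚ_p`-dimensions and `ℚ_p[π]` are taken over
`↥(qp p k)`.  All endomorphism algebras live in the ambient `ℚ_p`-algebra `A := Module.End (qp p k) V` of
`ℚ_p`-linear endomorphisms of `V`; the `σ`-semilinear `Φ` is referred to inside `A` through a variable `Φ₀ : A`
constrained by `IsFrob Φ₀ : ∀ v, Φ₀ v = Φ v` (such a `Φ₀` exists and is unique since `σ` fixes `ℚ_p`; this device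
keeps the file free of proof obligations), and `π_V := Φ^r` (p. 410 «the linear automorphism `π_V := Φ^r` of `V`»)
is `Φ₀ ^ r`.  `End_Φ(V) := {f ∈ End(V) | Φ f = f Φ}` (p. 410) is `EndPhi Φ₀` = the centralizer in `A` of `Φ₀` and of
the `L_r`-scalars (so its elements are exactly the `L_r`-linear maps commuting with `Φ`).  «We say that the
isocrystal `V` is semisimple if `π_V` is a semisimple endomorphism of the vector space `V`» = `IsSemisimpleObj`
(Mathlib's `Module.End.IsSemisimple` for the `L_r`-linear map that agrees with `Φ^r` pointwise).  The simple objects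
of «the category of all semisimple isocrystals over `L_r`» (a semisimple `ℚ_p`-linear abelian category, p. 410) are
the non-zero semisimple isocrystals without proper non-zero `Φ`-stable `L_r`-subspaces (`IsSimpleObj`).

## Faithfulness notes

* Lemma 11.3 (first clause) and Lemma 11.5 (the formula for `inv(C)`) assert values of HASSE INVARIANTS of central
  division algebras over the `p`-adic fields `ℚ_p[π]`, `F[π]`.  Neither Mathlib nor the tree has the local invariant
  `inv_E : Br(E) ≅ ℚ/ℤ` of a `p`-adic field `E` (cf. the `TODO(general form)` of
  `Literature/NumberTheory/GaloisCohomology/BrauerHassePrinciple.lean`); these two clauses are NOT typed and are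
  recorded verbatim in the docstrings with `TODO(general form)`.  The other clauses (dimension formulas, the
  bijections, the characteristic-polynomial criterion) are typed in full.
* Dimension formulas «`dim_{L_r} V = [E : ℚ_p] (dim_E C)^{1/2}`» (`E = ℚ_p[π]` resp. `F[π]`, `C` the endomorphism
  algebra) are typed squared and over `ℚ_p`: `(dim_{L_r} V)^2 = [E : ℚ_p] · dim_{ℚ_p} C` (resp. `· d^2`), using
  `dim_{ℚ_p} C = [E : ℚ_p] · dim_E C` — an identity, not an extra hypothesis.
* Lemma 11.6, second statement: «the quotient `m(π)/d` kills the class of `End(X_π)` in the Brauer group of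
  `F[π]`» is typed through the paper's own equivalent form (p. 412, last lines of the proof: «f arises from some V if
  and only if … the number `m(π)` is divisible by `d (dim_{F[π]} C)^{1/2}`», «`(dim_{F[π]} C)^{1/2}` is the order of
  `C` in the Brauer group of `F[π]`»): `d · e ∣ m(π)` where `e^2 = dim_{F[π]} C`.  The characteristic polynomial of
  a `B`-object (p. 411–412: «the characteristic polynomial of the `F ⊗_{ℚ_p} L_r`-linear map `π_V`», monic of degree
  `dim_{L_r}(V)/[F : ℚ_p]`, «coefficients … lie in `F`») is typed through the characteristic polynomial of `π_V` as
  an `F`-linear map, which equals its `r`-th power (`[L_r : ℚ_p] = r`; `det_F = N_{F⊗L_r/F} ∘ det_{F⊗L_r}`), and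
  `f ↦ f^r` is injective on monic polynomials over the field `F`; so «has characteristic polynomial `f`» is typed as
  `charpoly_F(π_V) = f ^ r`.
* `B`-objects `(V, Φ, i)` (p. 411: «`i` is a `ℚ_p`-algebra homomorphism `B → End_Φ(V)`») are typed unbundled: a
  `Module B V` structure whose action is `L_r`-linear, commutes with `Φ`, and restricts on `ℚ_p ⊂ B` to the scalar
  action (`IsBObject`); `F` = centre of `B` = `Subalgebra.center (qp p k) B`, and `d` is introduced by
  `dim_{ℚ_p} B = d^2 · dim_{ℚ_p} F` («define a positive integer `d` by `d^2 = dim_F(B)`»).  «Elements of `F̄^×` up to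
  conjugacy over `F`» ↔ simple objects: the bijection `π ↦ X_π` is typed by its graph — `X` corresponds to `π` iff
  there is an `F`-algebra map `F[π_X] → F̄` sending `π_X` to `π` — as (existence) every `π ≠ 0` is hit and
  (injectivity) two simple objects are isomorphic iff their `F[π]`'s are `F`-isomorphic with `π ↦ π'` (the form in
  which Lemma 11.2 prints the case `B = ℚ_p`).
* Universe: all carrier types in `Type`.

## References

* [Kottwitz1992] R. E. Kottwitz, *Points on some Shimura varieties over finite fields*, J. Amer. Math. Soc. 5
  (1992), 373–444; §11, pp. 410–412; §3 (Lemmas 3.1, 3.3) and §10 (Lemmas 10.10, 10.11, 10.13) are quoted by the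
  proofs.
-/

noncomputable section

open scoped Isocrystal
open WittVector Polynomial

namespace Literature.NumberTheory.Kottwitz1992.Isocrystals

/-! ## The setting of §11 (p. 410): `L_r = K(p,k)`, `ℚ_p ⊂ L_r`, `End_Φ(V)`, `π_V`, semisimple and simple objects -/

section Setting

variable (p : ℕ) [Fact p.Prime] (k : Type) [Field k] [Fintype k] [CharP k p]

/-- The copy of `ℚ_p` inside `L_r = K(p, k)`: the fixed ring of the Frobenius `σ` of `L_r` (for `k` the field
with `p^r` elements, `L_r` is the unramified extension of `ℚ_p` of degree `r` and `L_r^σ = ℚ_p`).  All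
«`ℚ_p`-algebra», «`ℚ_p[π]`», «`[· : ℚ_p]`» of §11 are taken over this ring. [cite: Kottwitz1992, §11 (p. 410)]
[folklore] -/
def qp : Subring K(p, k) :=
  RingHom.eqLocus (WittVector.FractionRing.frobeniusRingHom p k) (RingHom.id K(p, k))

variable (V : Type) [AddCommGroup V] [WittVector.Isocrystal p k V]

/-- The scalar `c ∈ L_r` acting on `V`, as an element of the ambient `ℚ_p`-algebra `Module.End (qp p k) V`.
[cite: Kottwitz1992, §11 (p. 410)] -/
def kScalar (c : K(p, k)) : Module.End (qp p k) V :=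
  (algebraMap K(p, k) (Module.End K(p, k) V) c).restrictScalars (qp p k)

/-- `Φ₀` is the `σ`-linear bijection `Φ` of the isocrystal `V`, regarded as a `ℚ_p`-linear endomorphism of `V`
(it agrees with `Φ(p, k)` pointwise; `Φ` is `ℚ_p`-linear because `σ` fixes `ℚ_p`). [cite: Kottwitz1992, §11 (p. 410)] -/
def IsFrob (Φ₀ : Module.End (qp p k) V) : Prop :=
  ∀ v : V, Φ₀ v = Φ(p, k) v

/-- `End_Φ(V) := {f ∈ End(V) | Φ f = f Φ}` — the `ℚ_p`-algebra of `L_r`-linear endomorphisms of `V` commuting with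
`Φ`, typed as the centralizer, in the `ℚ_p`-linear endomorphisms, of `Φ₀` and of all `L_r`-scalars.
[cite: Kottwitz1992, §11 (p. 410)] -/
def EndPhi (Φ₀ : Module.End (qp p k) V) : Subalgebra (qp p k) (Module.End (qp p k) V) :=
  Subalgebra.centralizer (qp p k) (insert Φ₀ (Set.range (kScalar p k V)))

/-- `ℚ_p[x]`: the `ℚ_p`-subalgebra of the `ℚ_p`-linear endomorphisms of `V` generated by `x` (used with `x = π_V`,
p. 410: «`ℚ_p[π_i]` denotes the `ℚ_p`-subalgebra of `End_Φ(V_i)` generated by `π_i`»). [cite: Kottwitz1992, Lemma 11.2 (p. 410)] -/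
def adjoinQp (x : Module.End (qp p k) V) : Subalgebra (qp p k) (Module.End (qp p k) V) :=
  Algebra.adjoin (qp p k) {x}

/-- The map `π_V = Φ^r` as a function `V → V` («the linear automorphism `π_V := Φ^r` of `V`», p. 410).
[cite: Kottwitz1992, §11 (p. 410)] -/
def piFun (r : ℕ) : V → V :=
  (fun v : V => Φ(p, k) v)^[r]

/-- A `Φ`-stable `L_r`-subspace of `V` (a subobject of the isocrystal `V`). [cite: Kottwitz1992, §11 (p. 410)] -/
def IsStable (W : Submodule K(p, k) V) : Prop :=
  ∀ v ∈ W, Φ(p, k) v ∈ W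

/-- «We say that the isocrystal `V` is semisimple if `π_V` is a semisimple endomorphism of the vector space `V`»:
the `L_r`-linear endomorphism of `V` that agrees with `Φ^r` pointwise is semisimple (Mathlib
`Module.End.IsSemisimple`; `Φ^r` is `L_r`-linear since `σ^r = 1` on `L_r`). [cite: Kottwitz1992, §11 (p. 410)] -/
def IsSemisimpleObj (r : ℕ) : Prop :=
  ∃ π : Module.End K(p, k) V, (∀ v : V, π v = piFun p k V r v) ∧ Module.End.IsSemisimple π

/-- A simple object of «the category of all semisimple isocrystals over `L_r`» (a semisimple abelian category,
p. 410, by Lemma 3.1): a non-zero semisimple isocrystal whose only `Φ`-stable `L_r`-subspaces are `0` and `V`.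
[cite: Kottwitz1992, §11 (p. 410)] -/
def IsSimpleObj (r : ℕ) : Prop :=
  IsSemisimpleObj p k V r ∧ Nontrivial V ∧ ∀ W : Submodule K(p, k) V, IsStable p k V W → W = ⊥ ∨ W = ⊤

end Setting

/-! ## Lemmas 11.1–11.4 (pp. 410–411) -/

section SimpleObjects

variable (p : ℕ) [Fact p.Prime] (r : ℕ) (k : Type) [Field k] [Fintype k] [CharP k p]
variable (V : Type) [AddCommGroup V] [WittVector.Isocrystal p k V] [Module.Finite K(p, k) V]

/-- **Lemma 11.1.** «Suppose that `V` is a semisimple isocrystal. Then the center of `End_Φ(V)` is generated by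
`π_V`.» — i.e. the centre of the `ℚ_p`-algebra `End_Φ(V)` equals `ℚ_p[π_V]`.  Here `k` has `p^r` elements,
`L_r = K(p,k)`, `Φ₀` is `Φ` seen `ℚ_p`-linearly and `π_V = Φ₀ ^ r`. [cite: Kottwitz1992, Lemma 11.1 (p. 410)] -/
def Kottwitz1992_11_1_center_eq_adjoin_pi : Prop :=
  Fintype.card k = p ^ r → IsSemisimpleObj p k V r →
    ∀ Φ₀ : Module.End (qp p k) V, IsFrob p k V Φ₀ →
      EndPhi p k V Φ₀ ⊓ Subalgebra.centralizer (qp p k) (EndPhi p k V Φ₀ : Set (Module.End (qp p k) V)) =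
        adjoinQp p k V (Φ₀ ^ r)

variable (V' : Type) [AddCommGroup V'] [WittVector.Isocrystal p k V'] [Module.Finite K(p, k) V']

/-- **Lemma 11.2.** «Suppose that `V₁`, `V₂` are simple objects in the category of semisimple isocrystals. Then
`V₁`, `V₂` are isomorphic if and only if there exists a `ℚ_p`-algebra isomorphism `ℚ_p[π₁] → ℚ_p[π₂]` carrying `π₁`
into `π₂`, where `ℚ_p[π_i]` denotes the `ℚ_p`-subalgebra of `End_Φ(V_i)` generated by `π_i`.» (proof: «Use the
method of proof of Lemma 10.10.»)  Isomorphism of isocrystals = Mathlib `V ≃ᶠⁱ[p, k] V'`.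
[cite: Kottwitz1992, Lemma 11.2 (p. 410)] -/
def Kottwitz1992_11_2_simple_iso_iff : Prop :=
  Fintype.card k = p ^ r → IsSimpleObj p k V r → IsSimpleObj p k V' r →
    ∀ Φ₁ : Module.End (qp p k) V, IsFrob p k V Φ₁ → ∀ Φ₂ : Module.End (qp p k) V', IsFrob p k V' Φ₂ →
      (Nonempty (V ≃ᶠⁱ[p, k] V') ↔
        ∃ e : adjoinQp p k V (Φ₁ ^ r) ≃ₐ[qp p k] adjoinQp p k V' (Φ₂ ^ r),
          ∀ x : adjoinQp p k V (Φ₁ ^ r),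
            (x : Module.End (qp p k) V) = Φ₁ ^ r → (e x : Module.End (qp p k) V') = Φ₂ ^ r)

/-- **Lemma 11.3.** «Let `V` be a simple object in the category of semisimple isocrystals, and write `π` for `π_V`.
Then the Hasse invariant of the central division algebra `End_Φ(V)` over `ℚ_p[π]` is
`-[ℚ_p[π] : ℚ_p] · v(π)/v(p^r)`, where `v` denotes the valuation on `ℚ_p[π]`. Moreover the following equality
holds: `dim_{L_r}(V) = [ℚ_p[π] : ℚ_p] (dim_{ℚ_p[π]} End_Φ(V))^{1/2}`.» (proof via isotypic isocrystals over `L` of slope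
`v(π)/v(p^r)`, p. 410–411.)  TYPED: the dimension equality, squared and over `ℚ_p`:
`(dim_{L_r} V)^2 = [ℚ_p[π] : ℚ_p] · dim_{ℚ_p} End_Φ(V)`.
-- TODO(general form): the Hasse-invariant clause `inv_{ℚ_p[π]}(End_Φ(V)) = -[ℚ_p[π]:ℚ_p]·v(π)/v(p^r)` is not typed
-- (no Mathlib/tree notion of the local invariant `Br(E) ≅ ℚ/ℤ` of a `p`-adic field `E`).
[cite: Kottwitz1992, Lemma 11.3 (p. 410)] -/
def Kottwitz1992_11_3_finrank_sq : Prop :=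
  Fintype.card k = p ^ r → IsSimpleObj p k V r →
    ∀ Φ₀ : Module.End (qp p k) V, IsFrob p k V Φ₀ →
      (Module.finrank K(p, k) V) ^ 2 =
        Module.finrank (qp p k) (adjoinQp p k V (Φ₀ ^ r)) * Module.finrank (qp p k) (EndPhi p k V Φ₀)

/-- **Lemma 11.4.** «Every element `π ∈ ℚ̄_p^×` arises from some simple isocrystal `V`.» (p. 411: «The image of
`π := π_V` under an embedding `ℚ_p[π] → ℚ̄_p` is an element of `ℚ̄_p^×` whose `Gal(ℚ̄_p/ℚ_p)`-orbit is independent of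
the choice of embedding.»)  Typed: for every algebraic closure `Ω` of `ℚ_p = qp p k` and every `π ∈ Ω`, `π ≠ 0`,
there is a simple object `V` (of the category of semisimple isocrystals over `L_r`) and a `ℚ_p`-algebra map
`ℚ_p[π_V] → Ω` sending `π_V` to `π`. [cite: Kottwitz1992, Lemma 11.4 (p. 411)] -/
def Kottwitz1992_11_4_exists_simple : Prop :=
  Fintype.card k = p ^ r →
    ∀ (Ω : Type) [Field Ω] [Algebra (qp p k) Ω] [Module.IsTorsionFree (qp p k) Ω] [IsAlgClosure (qp p k) Ω]
      (π : Ω), π ≠ 0 →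
      ∃ (W : Type) (_ : AddCommGroup W) (_ : WittVector.Isocrystal p k W) (_ : Module.Finite K(p, k) W)
        (Φ₀ : Module.End (qp p k) W),
        IsFrob p k W Φ₀ ∧ IsSimpleObj p k W r ∧
          ∃ e : adjoinQp p k W (Φ₀ ^ r) →ₐ[qp p k] Ω,
            ∀ x : adjoinQp p k W (Φ₀ ^ r), (x : Module.End (qp p k) W) = Φ₀ ^ r → e x = π

end SimpleObjects

/-! ## `B`-objects: Lemmas 11.5–11.6 (pp. 411–412) -/

section BObjects

variable (p : ℕ) [Fact p.Prime] (r : ℕ) (k : Type) [Field k] [Fintype k] [CharP k p]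
variable (B : Type) [Ring B] [Algebra (qp p k) B]
variable (V : Type) [AddCommGroup V] [WittVector.Isocrystal p k V] [Module.Finite K(p, k) V]
variable [Module B V] [SMulCommClass B (qp p k) V]

/-- The action of `b ∈ B` on a `B`-object `V`, as an element of the ambient `ℚ_p`-algebra `Module.End (qp p k) V`.
[cite: Kottwitz1992, §11 (p. 411)] -/
def bAct (b : B) : Module.End (qp p k) V :=
  DistribSMul.toLinearMap (qp p k) V b

/-- An object `(V, Φ, i)` of the category `𝒞_B` of `B`-objects in the category `𝒞` of semisimple isocrystals over
`L_r` (p. 411: «`(V, Φ)` is an isocrystal over `L_r` and `i` is a `ℚ_p`-algebra homomorphism `B → End_Φ(V)`»),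
typed unbundled on a `Module B V` structure: `V` is semisimple, `B` acts `L_r`-linearly, the action commutes with
`Φ`, and `ℚ_p ⊂ B` acts through the scalars `ℚ_p ⊂ L_r`. [cite: Kottwitz1992, §11 (p. 411)] -/
def IsBObject : Prop :=
  IsSemisimpleObj p k V r ∧
    (∀ (b : B) (c : K(p, k)) (v : V), b • c • v = c • b • v) ∧
    (∀ (b : B) (v : V), Φ(p, k) (b • v) = b • Φ(p, k) v) ∧
    (∀ (c : qp p k) (v : V), algebraMap (qp p k) B c • v = (c : K(p, k)) • v)

/-- A simple object of `𝒞_B`: a non-zero `B`-object whose only `Φ`-stable, `B`-stable `L_r`-subspaces are `0`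
and `V`. [cite: Kottwitz1992, §11 (p. 411)] -/
def IsSimpleBObject : Prop :=
  IsBObject p r k B V ∧ Nontrivial V ∧
    ∀ W : Submodule K(p, k) V, IsStable p k V W → (∀ (b : B), ∀ v ∈ W, b • v ∈ W) → W = ⊥ ∨ W = ⊤

/-- `End(X)` for an object `X = (V, Φ, i)` of `𝒞_B`: the `ℚ_p`-algebra of `L_r`-linear endomorphisms of `V`
commuting with `Φ` and with `B` (centralizer of `Φ₀`, the `L_r`-scalars and the `B`-action).
[cite: Kottwitz1992, Lemma 11.5 (p. 411)] -/
def EndB (Φ₀ : Module.End (qp p k) V) : Subalgebra (qp p k) (Module.End (qp p k) V) :=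
  Subalgebra.centralizer (qp p k) (insert Φ₀ (Set.range (kScalar p k V) ∪ Set.range (bAct p k B V)))

/-- `F[π]` for an object of `𝒞_B` (p. 411), `F` = centre of `B`: the `ℚ_p`-subalgebra of the `ℚ_p`-linear
endomorphisms of `V` generated by the action of `F` and by `π_V = Φ₀ ^ r`. [cite: Kottwitz1992, Lemma 11.5 (p. 411)] -/
def adjoinF (Φ₀ : Module.End (qp p k) V) : Subalgebra (qp p k) (Module.End (qp p k) V) :=
  Algebra.adjoin (qp p k)
    (Set.range (fun c : Subalgebra.center (qp p k) B => bAct p k B V (c : B)) ∪ {Φ₀ ^ r})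

/-- **Lemma 11.5 (existence half of the bijection).** Setting (p. 411): `B` a finite-dimensional simple algebra over
`ℚ_p` with centre `F` («a `p`-adic field»), `d` the positive integer with `d^2 = dim_F(B)`; for `π ∈ F̄^×` the
simple object `X_π` of `𝒞_B` is constructed from the simple isocrystal `Y_π` of Lemma 11.4 and the surjection
`F ⊗_{ℚ_p} ℚ_p[π] → F[π]` (§3).  «**Lemma 11.5.** The construction `π ↦ X_π` sets up a bijection between elements of
`F̄^×` up to conjugacy over `F` and isomorphism classes of simple objects in `𝒞_B`. …»  This fact types «every
class is hit»: for every algebraic closure `Ω` of `F` and every `π ∈ Ω`, `π ≠ 0`, there is a simple object `X` of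
`𝒞_B` with an `F`-algebra map `F[π_X] → Ω` sending `π_X` to `π`. [cite: Kottwitz1992, Lemma 11.5 (p. 411)] -/
def Kottwitz1992_11_5_simple_exists : Prop :=
  Fintype.card k = p ^ r → IsSimpleRing B → Module.Finite (qp p k) B →
    ∀ (Ω : Type) [Field Ω] [Algebra (Subalgebra.center (qp p k) B) Ω]
      [Module.IsTorsionFree (Subalgebra.center (qp p k) B) Ω] [IsAlgClosure (Subalgebra.center (qp p k) B) Ω]
      (π : Ω), π ≠ 0 →
      ∃ (X : Type) (_ : AddCommGroup X) (_ : WittVector.Isocrystal p k X) (_ : Module.Finite K(p, k) X)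
        (_ : Module B X) (_ : SMulCommClass B (qp p k) X) (Φ₀ : Module.End (qp p k) X),
        IsFrob p k X Φ₀ ∧ IsSimpleBObject p r k B X ∧
          ∃ e : adjoinF p r k B X Φ₀ →+* Ω,
            (∀ (x : adjoinF p r k B X Φ₀) (c : Subalgebra.center (qp p k) B),
                (x : Module.End (qp p k) X) = bAct p k B X (c : B) →
                  e x = algebraMap (Subalgebra.center (qp p k) B) Ω c) ∧
            ∀ x : adjoinF p r k B X Φ₀, (x : Module.End (qp p k) X) = Φ₀ ^ r → e x = π

variable (V' : Type) [AddCommGroup V'] [WittVector.Isocrystal p k V'] [Module.Finite K(p, k) V']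
variable [Module B V'] [SMulCommClass B (qp p k) V']

/-- **Lemma 11.5 (injectivity half of the bijection).** «… a bijection between elements of `F̄^×` up to conjugacy
over `F` and isomorphism classes of simple objects in `𝒞_B`»: two simple objects `X`, `X'` of `𝒞_B` are isomorphic
(an isomorphism of isocrystals commuting with `B`) if and only if there is a ring isomorphism `F[π_X] → F[π_{X'}]`
that is the identity on `F` and carries `π_X` to `π_{X'}` (i.e. `π_X`, `π_{X'}` are conjugate over `F`; the case
`B = ℚ_p` is Lemma 11.2). [cite: Kottwitz1992, Lemma 11.5 (p. 411)] -/
def Kottwitz1992_11_5_simple_iso_iff : Prop :=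
  Fintype.card k = p ^ r → IsSimpleRing B → Module.Finite (qp p k) B →
    IsSimpleBObject p r k B V → IsSimpleBObject p r k B V' →
    ∀ Φ₁ : Module.End (qp p k) V, IsFrob p k V Φ₁ → ∀ Φ₂ : Module.End (qp p k) V', IsFrob p k V' Φ₂ →
      ((∃ e : V ≃ᶠⁱ[p, k] V', ∀ (b : B) (v : V), e.toLinearEquiv (b • v) = b • e.toLinearEquiv v) ↔
        ∃ e : adjoinF p r k B V Φ₁ ≃+* adjoinF p r k B V' Φ₂,
          (∀ (x : adjoinF p r k B V Φ₁) (c : Subalgebra.center (qp p k) B),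
              (x : Module.End (qp p k) V) = bAct p k B V (c : B) →
                (e x : Module.End (qp p k) V') = bAct p k B V' (c : B)) ∧
          ∀ x : adjoinF p r k B V Φ₁,
            (x : Module.End (qp p k) V) = Φ₁ ^ r → (e x : Module.End (qp p k) V') = Φ₂ ^ r)

/-- **Lemma 11.5 (the endomorphism algebra).** «The endomorphism algebra `End(X_π)` is a central division algebra `C`
over `F[π]` whose Hasse invariant is given by `inv(C) = -[F[π] : ℚ_p] v(π)/v(p^r) - [F[π] : F] inv(B)`, where `v`
denotes the valuation on `F[π]`. Moreover the dimension of the `L_r`-vector space underlying `X_π` is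
`d [F[π] : ℚ_p] (dim_{F[π]} C)^{1/2}`.» («The lemma follows immediately from Lemmas 11.3 and 3.3.»)  TYPED, for every
simple object `X` of `𝒞_B` with `C = End(X)`: `C` is a division ring, its centre is `F[π_X]`, and
`(dim_{L_r} X)^2 = d^2 · [F[π_X] : ℚ_p] · dim_{ℚ_p} C` (= the printed formula squared, with
`dim_{ℚ_p} C = [F[π]:ℚ_p] dim_{F[π]} C`); `d` enters through `dim_{ℚ_p} B = d^2 dim_{ℚ_p} F`.
-- TODO(general form): the Hasse-invariant formula `inv(C) = -[F[π]:ℚ_p] v(π)/v(p^r) - [F[π]:F] inv(B)` is not typed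
-- (no Mathlib/tree notion of the local invariant of a central simple algebra over a `p`-adic field).
[cite: Kottwitz1992, Lemma 11.5 (p. 411)] -/
def Kottwitz1992_11_5_endomorphism_algebra (d : ℕ) : Prop :=
  Fintype.card k = p ^ r → IsSimpleRing B → Module.Finite (qp p k) B →
    Module.finrank (qp p k) B = d ^ 2 * Module.finrank (qp p k) (Subalgebra.center (qp p k) B) →
    IsSimpleBObject p r k B V →
    ∀ Φ₀ : Module.End (qp p k) V, IsFrob p k V Φ₀ →
      (∀ f : EndB p k B V Φ₀, f ≠ 0 → IsUnit f) ∧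
      EndB p k B V Φ₀ ⊓ Subalgebra.centralizer (qp p k) (EndB p k B V Φ₀ : Set (Module.End (qp p k) V)) =
        adjoinF p r k B V Φ₀ ∧
      (Module.finrank K(p, k) V) ^ 2 =
        d ^ 2 * Module.finrank (qp p k) (adjoinF p r k B V Φ₀) * Module.finrank (qp p k) (EndB p k B V Φ₀)

variable [Module (Subalgebra.center (qp p k) B) V] [Module.Free (Subalgebra.center (qp p k) B) V]
  [Module.Finite (Subalgebra.center (qp p k) B) V]
variable [Module (Subalgebra.center (qp p k) B) V'] [Module.Free (Subalgebra.center (qp p k) B) V']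
  [Module.Finite (Subalgebra.center (qp p k) B) V']

/-- **Lemma 11.6 (first statement).** For an object `(V, Φ, i)` of `𝒞_B`, `V` is a free `F ⊗_{ℚ_p} L_r`-module and
one considers «the characteristic polynomial of the `F ⊗_{ℚ_p} L_r`-linear map `π_V`», monic of degree
`dim_{L_r}(V)/[F : ℚ_p]` with coefficients in `F` (pp. 411–412).  «**Lemma 11.6.** The isomorphism class of an object
in `𝒞_B` is determined by its characteristic polynomial.»  TYPED with `F` acting on `V` through `B`
(`c • v = (c : B) • v`) and the characteristic polynomial of `π_V` as an `F`-LINEAR map (= the `r`-th power of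
the printed one, see the file's faithfulness notes): two objects of `𝒞_B` whose `F`-linear `π_V`'s have the same
characteristic polynomial are isomorphic in `𝒞_B`. [cite: Kottwitz1992, Lemma 11.6 (p. 412)] -/
def Kottwitz1992_11_6_charpoly_determines : Prop :=
  Fintype.card k = p ^ r → IsSimpleRing B → Module.Finite (qp p k) B →
    IsBObject p r k B V → IsBObject p r k B V' →
    (∀ (c : Subalgebra.center (qp p k) B) (v : V), c • v = (c : B) • v) →
    (∀ (c : Subalgebra.center (qp p k) B) (v : V'), c • v = (c : B) • v) →
    ∀ πF : Module.End (Subalgebra.center (qp p k) B) V, (∀ v, πF v = piFun p k V r v) →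
    ∀ πF' : Module.End (Subalgebra.center (qp p k) B) V', (∀ v, πF' v = piFun p k V' r v) →
      πF.charpoly = πF'.charpoly →
        ∃ e : V ≃ᶠⁱ[p, k] V', ∀ (b : B) (v : V), e.toLinearEquiv (b • v) = b • e.toLinearEquiv v

/-- **Lemma 11.6 (second statement).** «Now let `f ∈ F[T]` be a monic polynomial of degree `m` and for `π ∈ F̄^×`
denote by `m(π)` the multiplicity of `π` as root of `f`. … The polynomial `f` arises from an `m[F : ℚ_p]`-dimensional
object of `𝒞_B` if and only if the following statement holds for all `π ∈ F̄^×`: the number `m(π)` is divisible by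
`d` and the quotient `m(π)/d` kills the class of `End(X_π)` in the Brauer group of `F[π]`.»  TYPED: LHS = there is
an object `V` of `𝒞_B` with `dim_{L_r} V = m · dim_{ℚ_p} F` whose `F`-linear `π_V` has characteristic polynomial
`f^r` (faithfulness notes); RHS = for every `π ∈ Ω = F̄`, `π ≠ 0`, and every simple object `X` of `𝒞_B` with an
`F`-algebra map `F[π_X] → Ω`, `π_X ↦ π` (i.e. `X ≅ X_π`), `d · e ∣ m(π)` where `e^2 = dim_{F[π_X]} End(X)` — the
paper's own equivalent of «`m(π)/d` kills the class», p. 412: «`(dim_{F[π]} C)^{1/2}` is the order of `C` in the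
Brauer group of `F[π]`». [cite: Kottwitz1992, Lemma 11.6 (p. 412)] -/
def Kottwitz1992_11_6_charpoly_realizable (d m : ℕ) : Prop :=
  Fintype.card k = p ^ r → IsSimpleRing B → Module.Finite (qp p k) B →
    Module.finrank (qp p k) B = d ^ 2 * Module.finrank (qp p k) (Subalgebra.center (qp p k) B) →
    ∀ (Ω : Type) [Field Ω] [Algebra (Subalgebra.center (qp p k) B) Ω]
      [Module.IsTorsionFree (Subalgebra.center (qp p k) B) Ω] [IsAlgClosure (Subalgebra.center (qp p k) B) Ω]
      (f : Polynomial (Subalgebra.center (qp p k) B)), f.Monic → f.natDegree = m →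
      ((∃ (X : Type) (_ : AddCommGroup X) (_ : WittVector.Isocrystal p k X) (_ : Module.Finite K(p, k) X)
          (_ : Module B X) (_ : SMulCommClass B (qp p k) X)
          (_ : Module (Subalgebra.center (qp p k) B) X) (_ : Module.Free (Subalgebra.center (qp p k) B) X)
          (_ : Module.Finite (Subalgebra.center (qp p k) B) X)
          (πF : Module.End (Subalgebra.center (qp p k) B) X),
          IsBObject p r k B X ∧ (∀ (c : Subalgebra.center (qp p k) B) (v : X), c • v = (c : B) • v) ∧
            (∀ v, πF v = piFun p k X r v) ∧
            Module.finrank K(p, k) X = m * Module.finrank (qp p k) (Subalgebra.center (qp p k) B) ∧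
            πF.charpoly = f ^ r) ↔
        ∀ (π : Ω), π ≠ 0 →
          ∀ (X : Type) [AddCommGroup X] [WittVector.Isocrystal p k X] [Module.Finite K(p, k) X]
            [Module B X] [SMulCommClass B (qp p k) X] (Φ₀ : Module.End (qp p k) X),
            IsFrob p k X Φ₀ → IsSimpleBObject p r k B X →
            ∀ e : adjoinF p r k B X Φ₀ →+* Ω,
              (∀ (x : adjoinF p r k B X Φ₀) (c : Subalgebra.center (qp p k) B),
                  (x : Module.End (qp p k) X) = bAct p k B X (c : B) →
                    e x = algebraMap (Subalgebra.center (qp p k) B) Ω c) →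
              (∀ x : adjoinF p r k B X Φ₀, (x : Module.End (qp p k) X) = Φ₀ ^ r → e x = π) →
              ∃ e' : ℕ,
                Module.finrank (qp p k) (EndB p k B X Φ₀) =
                    e' ^ 2 * Module.finrank (qp p k) (adjoinF p r k B X Φ₀) ∧
                  d * e' ∣ (f.map (algebraMap (Subalgebra.center (qp p k) B) Ω)).rootMultiplicity π)

end BObjects

/-! ## ED. 2: `ℚ_p ⊂ L_r` as a subfield (review note on p847760: downstream provers need a `Field` structure on `ℚ_p`) -/

section QpSubfield

variable (p : ℕ) [Fact p.Prime] (k : Type) [Field k] [Fintype k] [CharP k p]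

/-- The copy of `ℚ_p` inside `L_r = K(p, k)` as a SUBFIELD: the fixed field of the Frobenius `σ` (same carrier as the
subring `qp p k`, which is closed under inverses since `σ(x⁻¹) = σ(x)⁻¹`); `↥(qpSubfield p k)` carries Mathlib's `Field`
structure, for provers discharging the §11 facts (all of which are stated over `qp p k`; the identities
`(qpSubfield p k).toSubring = qp p k` and `x ∈ qpSubfield p k ↔ σ x = x` hold by `rfl` / `Iff.rfl`).
[cite: Kottwitz1992, §11 (p. 410)] [folklore] -/
def qpSubfield : Subfield K(p, k) where
  toSubring := qp p k
  inv_mem' x hx := by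
    have hx' : WittVector.FractionRing.frobeniusRingHom p k x = x := hx
    show WittVector.FractionRing.frobeniusRingHom p k x⁻¹ = x⁻¹
    rw [map_inv₀, hx']

end QpSubfield

end Literature.NumberTheory.Kottwitz1992.Isocrystals
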